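import Mathlib
import Summits.NavierStokesRegularity.NavierStokesRegularity.Theorems.DssFarFieldSlavingBlowupTypeIDssProfileSimilarityEnstrophyTools
import Summits.NavierStokesRegularity.NavierStokesRegularity.Theorems.DssFarFieldSlavingBlowupTypeIDssProfileSimilarityEnstrophyIdentity
import Summits.NavierStokesRegularity.NavierStokesRegularity.Theorems.DssFarFieldSlavingBlowupTypeIDssProfileExplicitThreshold
import Literature.Analysis.FluidPDE.TaoEnstrophyLocalisationProofs
import Literature.Analysis.FluidPDE.VectorCalculusProofs
import HarnessLib

/-!
# E3′ / T31″ under (D): the time-only Type-I threshold `M < 1` — classical and CLASS level given (D_M)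
  (pub-ns-dss theory T38-SCOPE (S4) Row 2; route `DssFarFieldSlaving`, crux `BlowupTypeIDssProfile`,
  stmt-NavierStokesRegularity-0155 — SUPPORT; typer seat g7, 2026-08-23)

HONEST FRAMING. Conditional exclusion statements about a HYPOTHETICAL object (a Type-I rotated-DSS ancient mild solution /
its smooth Type-I representatives in the KNSS gauge): IF the scale-invariant gauge bounds (D) of orders 1, 2, 3 hold AND
the Type-I constant satisfies `M < 1` (`‖V(t,x)‖ ≤ M/√(−t)`), THEN the field vanishes. The class statement feeds the
EXISTING conditional wrapper `ExplicitThreshold.rdssClass_empty_of_explicitTimeThreshold` (whose hypothesis `h` is the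
theory seat's paper statement T31″) with `h` DISCHARGED modulo ONE NAMED input (D_M) — «every KNSS-gauge Type-I field
with the Type-I decay admits the gauge bounds of orders 1, 2, 3» — a regularity statement from the literature on Type-I
ancient mild solutions, NOT a tree theorem; so the class statement is CONDITIONAL on (D_M), exactly like the E29 wrapper
`rdssClass_hardyStretching_empty`. MECHANISM DSS-BLIND (red R-89 wording applies verbatim): factor, twist and
self-similarity are discarded. Census words on ACCEPT are the lead's (theory T38-S4-BINDERS Row 2: «E3′(time) EMPTY for
M < 1 given (D_M)»). Nothing numeric is asserted; no profile is claimed to exist or not to exist; nothing here bears on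
Navier–Stokes regularity or blow-up.

CONTENTS. `eq_zero_of_deriv_le_neg_mul` (the backward ODE lemma of the Tools file at a general rate `κ > 0`),
`integral_inner_convect_eq_neg_integral_inner_convect_self` (ONE more whole-space integration by parts under
integrability: `∫⟪(X·∇)U, X⟫ = −∫⟪U, (X·∇)X⟫` for `div X = 0`, `U` bounded), the stretching bound
**`integral_stretching_le_of_typeI`** (`Str(s) ≤ ∫|∇Ω|²_F + (M²/4) Z(s)`), `eq_zero_of_integral_norm_lerayVorticity_sq_eq_zero`
(`Z ≡ 0 ⇒ V ≡ 0`), the CLASSICAL theorem **`typeI_ancient_eq_zero_of_typeI_lt_one`** (`M < 1` + (D) ⇒ `V ≡ 0`), and the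
CLASS level: `timeThreshold_hypothesis_of_decay` ((D_M) ⇒ the hypothesis `h` of
`rdssClass_empty_of_explicitTimeThreshold`, VERBATIM) and **`rdssClass_empty_of_decay_of_typeI_lt_one`**. [this file; theory
T38-S4-BINDERS b8871306b6ef8c30 Row 2, EXPLICIT-THRESHOLDS row T31″ (DERIVED there; here a tree theorem GIVEN (D))]
-/

noncomputable section

set_option linter.dupNamespace false

namespace Summit.NavierStokesRegularity.NavierStokesRegularity.Theorems.SimilarityEnstrophy

open MeasureTheory Set Filter Topology Module Metric InnerProductSpace Function
open scoped RealInnerProductSpace Laplacian ContDiff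
open Literature.Analysis Literature.Analysis.FluidPDE
open Summit.NavierStokesRegularity.NavierStokesRegularity.Theorems.GaussianGap
open Summit.NavierStokesRegularity.NavierStokesRegularity.Theorems.PlanarEnergyAPriori

/-- **ODE Liouville lemma, general rate.** A non-negative differentiable function `Z` on `ℝ`,
bounded above, with `Z' ≤ −κ Z` everywhere for some `κ > 0`, vanishes identically
(reparametrise `σ ↦ σ/(2κ)` into the rate-`½` lemma `eq_zero_of_deriv_le_neg_half_mul`). [folklore] -/
theorem eq_zero_of_deriv_le_neg_mul {Z : ℝ → ℝ} (hd : Differentiable ℝ Z)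
    (hZ0 : ∀ s, 0 ≤ Z s) (hbdd : ∃ B, ∀ s, Z s ≤ B) {κ : ℝ} (hκ : 0 < κ)
    (hZ' : ∀ s, deriv Z s ≤ -κ * Z s) : ∀ s, Z s = 0 := by
  have hκ0 : κ ≠ 0 := hκ.ne'
  have h2κ : (2 * κ) ≠ 0 := by positivity
  set W : ℝ → ℝ := fun σ => Z (σ / (2 * κ)) with hW
  have hWd : ∀ σ, HasDerivAt W (deriv Z (σ / (2 * κ)) * (1 / (2 * κ))) σ := fun σ =>
    (hd _).hasDerivAt.comp σ ((hasDerivAt_id' σ).div_const (2 * κ))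
  have hdW : Differentiable ℝ W := fun σ => (hWd σ).differentiableAt
  have hW0 : ∀ σ, 0 ≤ W σ := fun σ => hZ0 _
  have hWb : ∃ B, ∀ σ, W σ ≤ B := hbdd.imp fun B hB σ => hB _
  have hW' : ∀ σ, deriv W σ ≤ -(1 / 2) * W σ := fun σ => by
    rw [(hWd σ).deriv]
    calc deriv Z (σ / (2 * κ)) * (1 / (2 * κ))
        ≤ -κ * Z (σ / (2 * κ)) * (1 / (2 * κ)) :=
          mul_le_mul_of_nonneg_right (hZ' _) (by positivity)
      _ = -(1 / 2) * Z (σ / (2 * κ)) := by field_simp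
  intro s
  have h := eq_zero_of_deriv_le_neg_half_mul hdW hW0 hWb hW' (s * (2 * κ))
  have e : s * (2 * κ) / (2 * κ) = s := mul_div_cancel_right₀ s h2κ
  simp only [hW, e] at h
  exact h

section IBP

variable {E : Type*} [NormedAddCommGroup E] [InnerProductSpace ℝ E] [FiniteDimensional ℝ E]
  [MeasurableSpace E] [BorelSpace E]

/-- **Moving the derivative off the stretched field:** `∫ ⟪(X·∇)U, X⟫ = −∫ ⟪U, (X·∇)X⟫` for smooth
`X, U : E → E` with `div X = 0`, `U` bounded, `|X|² ∈ L¹` and both pairings integrable — no decay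
RATE required (the trilinear identity `integral_inner_convect_add_eq_zero` with `(u, v, w) =
(X, U, χ_R X)`, error `|Dχ_R(X) ⟪U, X⟫| ≤ (cM/R)|X|²`, `R → ∞`; pattern of
`integral_inner_convect_self_eq_zero`). For `X = Ω = curl U` this is the vortex-stretching
integration by parts `∫ Ωᵀ(∇U)Ω = −∫ U·((Ω·∇)Ω)`. [folklore] -/
theorem integral_inner_convect_eq_neg_integral_inner_convect_self {X U : E → E}
    (hX : ContDiff ℝ ∞ X) (hU : ContDiff ℝ ∞ U) (hdiv : VectorCalculus.IsDivFree X)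
    {M : ℝ} (hUb : ∀ x, ‖U x‖ ≤ M) (hX2 : Integrable fun x => ‖X x‖ ^ 2)
    (hS : Integrable fun x => ⟪convect X U x, X x⟫)
    (hT : Integrable fun x => ⟪U x, convect X X x⟫) :
    ∫ x, ⟪convect X U x, X x⟫ = -∫ x, ⟪U x, convect X X x⟫ := by
  obtain ⟨c, hc0, hc⟩ := exists_norm_fderiv_cutoff_le (E := E)
  have hX1 : ContDiff ℝ 1 X := hX.of_le (by norm_cast)
  have hU1 : ContDiff ℝ 1 U := hU.of_le (by norm_cast)
  have hdX : ∀ y, DifferentiableAt ℝ X y := fun y => hX1.differentiable one_ne_zero y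
  have hcXX : Continuous (convect X X) := by
    have : convect X X = fun y => fderiv ℝ X y (X y) := by funext y; rfl
    rw [this]; exact (hX1.continuous_fderiv one_ne_zero).clm_apply hX.continuous
  set Φ : ℕ → ℝ := fun n => (∫ x, cutoff ((n : ℝ) + 1) x * ⟪convect X U x, X x⟫) +
    ((∫ x, fderiv ℝ (cutoff ((n : ℝ) + 1)) x (X x) * ⟪U x, X x⟫) +
      ∫ x, cutoff ((n : ℝ) + 1) x * ⟪U x, convect X X x⟫) with hΦ
  -- the cut-off identity at `R = n + 1`
  have hn : ∀ n : ℕ, Φ n = 0 := by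
    intro n
    set φ : E → ℝ := cutoff ((n : ℝ) + 1) with hφ
    have hφs : ContDiff ℝ 1 φ := contDiff_cutoff _
    have hφc : HasCompactSupport φ := hasCompactSupport_cutoff (by positivity)
    have hdφ : ∀ y, DifferentiableAt ℝ φ y := fun y => hφs.differentiable one_ne_zero y
    have hw : ContDiff ℝ 1 fun z => φ z • X z := hφs.smul hX1
    have hwc : HasCompactSupport fun z => φ z • X z := hφc.smul_right
    have key := integral_inner_convect_add_eq_zero hX1 hU1 hw hwc
    have e1 : ∀ y, ⟪convect X U y, φ y • X y⟫ = φ y * ⟪convect X U y, X y⟫ := fun y => by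
      rw [real_inner_smul_right]
    have e2 : ∀ y, ⟪U y, convect X (fun z => φ z • X z) y⟫ =
        fderiv ℝ φ y (X y) * ⟪U y, X y⟫ + φ y * ⟪U y, convect X X y⟫ := fun y => by
      rw [convect_apply, fderiv_smul_apply_of_differentiableAt (hdφ y) (hdX y), inner_add_right,
        real_inner_smul_right, real_inner_smul_right, convect_apply]
    have e3 : ∀ y, VectorCalculus.divergence X y * ⟪U y, φ y • X y⟫ = 0 := fun y => by
      rw [hdiv y, zero_mul]
    have iA : Integrable (fun y => fderiv ℝ φ y (X y) * ⟪U y, X y⟫) := by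
      refine (((hφs.continuous_fderiv one_ne_zero).clm_apply hX.continuous).mul
        (hU.continuous.inner hX.continuous)).integrable_of_hasCompactSupport ?_
      exact HasCompactSupport.intro hφc fun y hy => by simp [fderiv_of_notMem_tsupport ℝ hy]
    have iB : Integrable (fun y => φ y * ⟪U y, convect X X y⟫) :=
      (hφs.continuous.mul (hU.continuous.inner hcXX)).integrable_of_hasCompactSupport hφc.mul_right
    have s1 : ∫ y, ⟪convect X U y, φ y • X y⟫ = ∫ y, φ y * ⟪convect X U y, X y⟫ :=
      integral_congr_ae (Eventually.of_forall e1)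
    have s2 : ∫ y, ⟪U y, convect X (fun z => φ z • X z) y⟫ =
        (∫ y, fderiv ℝ φ y (X y) * ⟪U y, X y⟫) + ∫ y, φ y * ⟪U y, convect X X y⟫ := by
      rw [← integral_add iA iB]
      exact integral_congr_ae (Eventually.of_forall e2)
    have s3 : ∫ y, VectorCalculus.divergence X y * ⟪U y, φ y • X y⟫ = 0 := by
      rw [integral_congr_ae (Eventually.of_forall e3)]; exact integral_zero E ℝ
    rw [s1, s2, s3, add_zero] at key
    exact key
  -- limits `R → ∞`
  have hS' := tendsto_integral_cutoff_mul hS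
  have hT' := tendsto_integral_cutoff_mul hT
  have hE : Tendsto (fun n : ℕ => ∫ x, fderiv ℝ (cutoff ((n : ℝ) + 1)) x (X x) * ⟪U x, X x⟫)
      atTop (𝓝 0) := by
    refine tendsto_integral_zero_of_norm_le_mul hX2 (ε := fun n => c / ((n : ℝ) + 1) * M) ?_ ?_
    · have h1 : Tendsto (fun n : ℕ => c / ((n : ℝ) + 1)) atTop (𝓝 0) :=
        tendsto_const_nhds.div_atTop (tendsto_natCast_atTop_atTop.atTop_add tendsto_const_nhds)
      simpa using h1.mul_const M
    · intro n x
      rw [norm_mul, norm_pow, norm_norm]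
      calc ‖fderiv ℝ (cutoff ((n : ℝ) + 1)) x (X x)‖ * ‖⟪U x, X x⟫‖
          ≤ (‖fderiv ℝ (cutoff ((n : ℝ) + 1)) x‖ * ‖X x‖) * (‖U x‖ * ‖X x‖) :=
            mul_le_mul (ContinuousLinearMap.le_opNorm _ _) (norm_inner_le_norm _ _)
              (norm_nonneg _) (by positivity)
        _ ≤ (c / ((n : ℝ) + 1) * ‖X x‖) * (M * ‖X x‖) :=
            mul_le_mul (mul_le_mul_of_nonneg_right (hc _ (by positivity) x) (norm_nonneg _))
              (mul_le_mul_of_nonneg_right (hUb x) (norm_nonneg _)) (by positivity)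
              (mul_nonneg (div_nonneg hc0 (by positivity)) (norm_nonneg _))
        _ = c / ((n : ℝ) + 1) * M * ‖X x‖ ^ 2 := by ring
  have hlim : Tendsto Φ atTop
      (𝓝 ((∫ x, ⟪convect X U x, X x⟫) + (0 + ∫ x, ⟪U x, convect X X x⟫))) :=
    hS'.add (hE.add hT')
  have hconst : Tendsto Φ atTop (𝓝 0) := by
    have : Φ = fun _ => (0 : ℝ) := funext hn
    rw [this]; exact tendsto_const_nhds
  have h0 := tendsto_nhds_unique hlim hconst
  linarith

end IBP

variable {M : ℝ} {V : ℝ → EuclideanSpace ℝ (Fin 3) → EuclideanSpace ℝ (Fin 3)}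

/-- `⟪U(s), DΩ(s) Ω(s)⟫ ∈ L¹(ℝ³)` under (D) at `k = 1, 2` (`‖U‖ ≤ M`, `‖DΩ‖ ≲ (1+|y|)^{−3}`,
`‖Ω‖ ≲ (1+|y|)^{−2}`). [folklore] -/
theorem integrable_inner_lerayOrbit_convect_lerayVorticity (hV : IsTypeIAncientMild M V)
    {C₁ C₂ : ℝ}
    (hD1 : ∀ t < 0, ∀ x, (‖x‖ + Real.sqrt (-t)) ^ (1 + 1) * ‖iteratedFDeriv ℝ 1 (V t) x‖ ≤ C₁)
    (hD2 : ∀ t < 0, ∀ x, (‖x‖ + Real.sqrt (-t)) ^ (2 + 1) * ‖iteratedFDeriv ℝ 2 (V t) x‖ ≤ C₂)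
    (s : ℝ) :
    Integrable fun y =>
      ⟪lerayOrbit V s y, convect (lerayVorticity V s) (lerayVorticity V s) y⟫ := by
  have hΩ := contDiff_lerayVorticity_slice hV s
  have hU := contDiff_lerayOrbit_slice_of_typeI hV s (n := 1) (by norm_cast)
  have hM : 0 ≤ M := hV.nonneg
  have hconv : Continuous (convect (lerayVorticity V s) (lerayVorticity V s)) := by
    have : convect (lerayVorticity V s) (lerayVorticity V s) =
        fun y => fderiv ℝ (lerayVorticity V s) y (lerayVorticity V s y) := by funext y; rfl
    rw [this]; exact (hΩ.continuous_fderiv (by simp)).clm_apply hΩ.continuous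
  refine integrable_of_le_decay_four (hU.continuous.inner hconv)
    (K := M * ((‖curlCLM‖ * C₂) * (‖curlCLM‖ * C₁))) fun y => ?_
  have h1 := norm_lerayOrbit_le_of_typeI hV s y
  have h2 := norm_fderiv_lerayVorticity_le_decay hV hD2 s y
  have h3 := norm_lerayVorticity_le_decay hV hD1 s y
  have h20 : 0 ≤ ‖curlCLM‖ * C₂ * (1 + ‖y‖) ^ (-(3 : ℝ)) := (norm_nonneg _).trans h2
  calc ‖⟪lerayOrbit V s y, convect (lerayVorticity V s) (lerayVorticity V s) y⟫‖
      ≤ ‖lerayOrbit V s y‖ * ‖convect (lerayVorticity V s) (lerayVorticity V s) y‖ :=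
        norm_inner_le_norm _ _
    _ ≤ ‖lerayOrbit V s y‖ * (‖fderiv ℝ (lerayVorticity V s) y‖ * ‖lerayVorticity V s y‖) := by
        rw [convect_apply]
        exact mul_le_mul_of_nonneg_left (ContinuousLinearMap.le_opNorm _ _) (norm_nonneg _)
    _ ≤ M * ((‖curlCLM‖ * C₂ * (1 + ‖y‖) ^ (-(3 : ℝ))) *
          (‖curlCLM‖ * C₁ * (1 + ‖y‖) ^ (-(2 : ℝ)))) :=
        mul_le_mul h1 (mul_le_mul h2 h3 (norm_nonneg _) h20) (by positivity) hM
    _ = M * ((‖curlCLM‖ * C₂) * (‖curlCLM‖ * C₁)) * (1 + ‖y‖) ^ (-((3 : ℝ) + 2)) := by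
        rw [← SlabLaw.rpow_neg_mul_rpow_neg]; ring
    _ ≤ M * ((‖curlCLM‖ * C₂) * (‖curlCLM‖ * C₁)) * (1 + ‖y‖) ^ (-(4 : ℝ)) := by
        have hK : 0 ≤ M * ((‖curlCLM‖ * C₂) * (‖curlCLM‖ * C₁)) := by
          have := decayConst_nonneg hD1; have := decayConst_nonneg hD2; positivity
        exact mul_le_mul_of_nonneg_left (SlabLaw.rpow_neg_le_rpow_neg_of_le y (by norm_num)) hK

/-- **The stretching bound from the Type-I bound alone** (theory EXPLICIT-THRESHOLDS row T31″):
`Str(s) = ∫⟪Ω, DU Ω⟫ ≤ ∫|∇Ω(s)|²_F + (M²/4) Z(s)` for a KNSS-gauge Type-I field (`‖U‖ ≤ M`) under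
(D) at `k = 1, 2`: move the derivative onto `Ω` (`∫ Ωᵀ(∇U)Ω = −∫ U·((Ω·∇)Ω)`, `div Ω = 0`), then
`|U·((Ω·∇)Ω)| ≤ M ‖DΩ‖_op ‖Ω‖ ≤ |DΩ|²_F + (M²/4)|Ω|²` pointwise. [this file; theory T31″] -/
theorem integral_stretching_le_of_typeI (hV : IsTypeIAncientMild M V) {C₁ C₂ : ℝ}
    (hD1 : ∀ t < 0, ∀ x, (‖x‖ + Real.sqrt (-t)) ^ (1 + 1) * ‖iteratedFDeriv ℝ 1 (V t) x‖ ≤ C₁)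
    (hD2 : ∀ t < 0, ∀ x, (‖x‖ + Real.sqrt (-t)) ^ (2 + 1) * ‖iteratedFDeriv ℝ 2 (V t) x‖ ≤ C₂)
    (s : ℝ) :
    ∫ y, ⟪lerayVorticity V s y, fderiv ℝ (lerayOrbit V s) y (lerayVorticity V s y)⟫ ≤
      (∫ y, frobeniusNormSq (fderiv ℝ (lerayVorticity V s) y)) +
        (M ^ 2 / 4) * ∫ y, ‖lerayVorticity V s y‖ ^ 2 := by
  have hΩ := contDiff_lerayVorticity_slice hV s
  have hU : ContDiff ℝ ∞ (lerayOrbit V s) := contDiff_lerayOrbit_slice_of_typeI hV s le_rfl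
  have hdiv : VectorCalculus.IsDivFree (lerayVorticity V s) := fun y =>
    divergence_curl_eq_zero_holds _ (hU.of_le (by norm_cast)) y
  have iZ := integrable_norm_lerayVorticity_sq hV hD1 s
  have iF := integrable_frobeniusNormSq_fderiv_lerayVorticity hV hD2 s
  have iS := integrable_inner_stretching_lerayVorticity hV hD1 s
  have iT := integrable_inner_lerayOrbit_convect_lerayVorticity hV hD1 hD2 s
  have iS' : Integrable fun y =>
      ⟪convect (lerayVorticity V s) (lerayOrbit V s) y, lerayVorticity V s y⟫ := by
    refine iS.congr (Eventually.of_forall fun y => ?_)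
    simp only [convect_apply]
    exact real_inner_comm _ _
  have hIBP := integral_inner_convect_eq_neg_integral_inner_convect_self hΩ hU hdiv
    (fun y => norm_lerayOrbit_le_of_typeI hV s y) iZ iS' iT
  have hStr : ∫ y, ⟪lerayVorticity V s y, fderiv ℝ (lerayOrbit V s) y (lerayVorticity V s y)⟫ =
      -∫ y, ⟪lerayOrbit V s y, convect (lerayVorticity V s) (lerayVorticity V s) y⟫ := by
    rw [← hIBP]
    refine integral_congr_ae (Eventually.of_forall fun y => ?_)
    simp only [convect_apply]
    exact real_inner_comm _ _
  rw [hStr, ← integral_neg, ← integral_const_mul, ← integral_add iF (iZ.const_mul _)]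
  refine integral_mono iT.neg (iF.add (iZ.const_mul _)) fun y => ?_
  dsimp only
  have hM : 0 ≤ M := hV.nonneg
  have hUy := norm_lerayOrbit_le_of_typeI hV s y
  have hop := sq_opNorm_le_frobeniusNormSq (fderiv ℝ (lerayVorticity V s) y)
  set a := ‖fderiv ℝ (lerayVorticity V s) y‖ with ha
  set b := ‖lerayVorticity V s y‖ with hb
  have h1 : -⟪lerayOrbit V s y, convect (lerayVorticity V s) (lerayVorticity V s) y⟫ ≤
      M * (a * b) := by
    calc -⟪lerayOrbit V s y, convect (lerayVorticity V s) (lerayVorticity V s) y⟫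
        ≤ ‖⟪lerayOrbit V s y, convect (lerayVorticity V s) (lerayVorticity V s) y⟫‖ := by
          rw [Real.norm_eq_abs]; exact neg_le_abs _
      _ ≤ ‖lerayOrbit V s y‖ * ‖convect (lerayVorticity V s) (lerayVorticity V s) y‖ :=
          norm_inner_le_norm _ _
      _ ≤ M * (a * b) := by
          rw [convect_apply]
          exact mul_le_mul hUy (ContinuousLinearMap.le_opNorm _ _) (norm_nonneg _) hM
  have h2 : M * (a * b) ≤ a ^ 2 + M ^ 2 / 4 * b ^ 2 := by
    nlinarith [sq_nonneg (a - M * b / 2)]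
  linarith

/-- If the similarity enstrophy vanishes at every `s`, the field vanishes: `Ω(s) ≡ 0` (continuity),
hence `curl V(t) ≡ 0` for `t < 0`, and a curl-free, divergence-free Type-I field is zero
(`eq_of_curl_eq_zero_of_isDivFree_of_bounded` + `IsTypeIAncientMild.eq_zero_of_slice_const`, as in
`GaussianGap.typeI_ancient_gaussianGap_eq_zero`). [folklore] -/
theorem eq_zero_of_integral_norm_lerayVorticity_sq_eq_zero (hV : IsTypeIAncientMild M V) {C₁ : ℝ}
    (hD1 : ∀ t < 0, ∀ x, (‖x‖ + Real.sqrt (-t)) ^ (1 + 1) * ‖iteratedFDeriv ℝ 1 (V t) x‖ ≤ C₁)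
    (hZ : ∀ s, ∫ y, ‖lerayVorticity V s y‖ ^ 2 = 0) :
    ∀ t < 0, ∀ x, V t x = 0 := by
  have hΩ0 : ∀ s y, lerayVorticity V s y = 0 := by
    intro s y
    have hc := (contDiff_lerayVorticity_slice hV s).continuous
    have hint := integrable_norm_lerayVorticity_sq hV hD1 s
    have hae : (fun y => ‖lerayVorticity V s y‖ ^ 2) =ᵐ[volume] 0 :=
      (integral_eq_zero_iff_of_nonneg (fun y => by positivity) hint).1 (hZ s)
    have hev : (fun y => ‖lerayVorticity V s y‖ ^ 2) = fun _ => (0 : ℝ) :=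
      ((hc.norm.pow 2).ae_eq_iff_eq (μ := volume) continuous_const).1 hae
    have := congrFun hev y
    simpa using this
  have hcurl : ∀ t < 0, ∀ x, curl (V t) x = 0 := by
    intro t ht x
    set s : ℝ := -Real.log (-t) with hs
    have hts : -Real.exp (-s) = t := by
      rw [hs, neg_neg, Real.exp_log (neg_pos.2 ht), neg_neg]
    have h := hΩ0 s ((Real.exp (-s / 2))⁻¹ • x)
    rw [lerayVorticity_apply, curl_lerayOrbit, smul_smul,
      mul_inv_cancel₀ (Real.exp_pos _).ne', one_smul, hts, smul_eq_zero] at h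
    exact h.resolve_left (Real.exp_pos _).ne'
  have hconst : ∀ t < 0, ∀ x, V t x = V t 0 := fun t ht x =>
    eq_of_curl_eq_zero_of_isDivFree_of_bounded ((hV.contDiff_slice ht).of_le (by norm_cast))
      (hcurl t ht) (hV.isDivFree ht) (fun z => hV.norm_le ht z) x 0
  exact fun t ht x => hV.eq_zero_of_slice_const (b := fun t => V t 0) hconst ht x

/-- **T31″ under (D), CLASSICAL level** (theory T38-S4-BINDERS Row 2; EXPLICIT-THRESHOLDS row T31″).
Let `V` be a KNSS-gauge Type-I field with Type-I constant `M < 1` (`‖V(t,x)‖ ≤ M/√(−t)`, the token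
of `IsTypeIAncientMild M V`) and the scale-invariant gauge bounds (D) of orders `1, 2, 3`
(`(‖x‖ + √(−t))^{k+1} ‖DᵏV(t,x)‖ ≤ C_k`). Then `V ≡ 0` on `t < 0`: by the similarity-enstrophy
identity `½Z' = −∫|∇Ω|²_F − ¼Z + Str` and `Str ≤ ∫|∇Ω|²_F + (M²/4)Z` one gets
`Z' ≤ −½(1 − M²) Z`; `Z ≥ 0` is bounded on `ℝ` by (D₁), so `Z ≡ 0` by the backward ODE lemma, and
`Z ≡ 0 ⇒ V ≡ 0`. The decay (D) is a NAMED hypothesis, not derived from Type-I membership here;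
nothing asserts it for a given field. [this file; theory T31″ («M_t < 1 ⇒ u ≡ 0», DERIVED there
with a paper decay input; here a tree theorem GIVEN (D)); nothing here bears on NS regularity] -/
theorem typeI_ancient_eq_zero_of_typeI_lt_one (hM : M < 1) (hV : IsTypeIAncientMild M V)
    {C₁ C₂ C₃ : ℝ}
    (hD1 : ∀ t < 0, ∀ x, (‖x‖ + Real.sqrt (-t)) ^ (1 + 1) * ‖iteratedFDeriv ℝ 1 (V t) x‖ ≤ C₁)
    (hD2 : ∀ t < 0, ∀ x, (‖x‖ + Real.sqrt (-t)) ^ (2 + 1) * ‖iteratedFDeriv ℝ 2 (V t) x‖ ≤ C₂)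
    (hD3 : ∀ t < 0, ∀ x, (‖x‖ + Real.sqrt (-t)) ^ (3 + 1) * ‖iteratedFDeriv ℝ 3 (V t) x‖ ≤ C₃) :
    ∀ t < 0, ∀ x, V t x = 0 := by
  set Z : ℝ → ℝ := fun σ => ∫ y, ‖lerayVorticity V σ y‖ ^ 2 with hZ
  have hZd := fun σ => similarityEnstrophy_hasDerivAt hV hD1 hD2 hD3 σ
  have hdiff : Differentiable ℝ Z := fun σ => (hZd σ).differentiableAt
  have hZ0 : ∀ σ, 0 ≤ Z σ := fun σ => integral_nonneg fun y => by positivity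
  -- `Z` bounded, from (D₁)
  have hc₀ := decayConst_nonneg hD1
  have hcont : Continuous fun y : EuclideanSpace ℝ (Fin 3) =>
      (‖curlCLM‖ * C₁) ^ 2 * (1 + ‖y‖) ^ (-(4 : ℝ)) :=
    continuous_const.mul ((continuous_const.add continuous_norm).rpow_const
      fun y => Or.inl (add_pos_of_pos_of_nonneg one_pos (norm_nonneg y)).ne')
  have imaj : Integrable fun y : EuclideanSpace ℝ (Fin 3) =>
      (‖curlCLM‖ * C₁) ^ 2 * (1 + ‖y‖) ^ (-(4 : ℝ)) :=
    integrable_of_le_decay_four hcont (K := (‖curlCLM‖ * C₁) ^ 2) fun y => by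
      rw [Real.norm_of_nonneg (by positivity)]
  have hbdd : ∃ B, ∀ σ, Z σ ≤ B := by
    refine ⟨∫ y : EuclideanSpace ℝ (Fin 3), (‖curlCLM‖ * C₁) ^ 2 * (1 + ‖y‖) ^ (-(4 : ℝ)),
      fun σ => ?_⟩
    refine integral_mono (integrable_norm_lerayVorticity_sq hV hD1 σ) imaj fun y => ?_
    have h := norm_lerayVorticity_le_decay hV hD1 σ y
    calc ‖lerayVorticity V σ y‖ ^ 2 ≤ (‖curlCLM‖ * C₁ * (1 + ‖y‖) ^ (-(2 : ℝ))) ^ 2 :=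
          pow_le_pow_left₀ (norm_nonneg _) h 2
      _ = (‖curlCLM‖ * C₁) ^ 2 * ((1 + ‖y‖) ^ (-(2 : ℝ)) * (1 + ‖y‖) ^ (-(2 : ℝ))) := by ring
      _ = (‖curlCLM‖ * C₁) ^ 2 * (1 + ‖y‖) ^ (-(4 : ℝ)) := by
          rw [SlabLaw.rpow_neg_mul_rpow_neg]; norm_num
  -- `Z' ≤ −½(1 − M²) Z`
  have hM0 : 0 ≤ M := hV.nonneg
  have hM1 : M ^ 2 < 1 := by nlinarith
  have hκ : 0 < (1 - M ^ 2) / 2 := by linarith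
  have hZ' : ∀ σ, deriv Z σ ≤ -((1 - M ^ 2) / 2) * Z σ := by
    intro σ
    rw [(hZd σ).deriv]
    have hS := integral_stretching_le_of_typeI hV hD1 hD2 σ
    have hZσ : Z σ = ∫ y, ‖lerayVorticity V σ y‖ ^ 2 := rfl
    rw [hZσ]
    linarith
  have hZzero := eq_zero_of_deriv_le_neg_mul hdiff hZ0 hbdd hκ hZ'
  exact eq_zero_of_integral_norm_lerayVorticity_sq_eq_zero hV hD1 hZzero

/-- **(D_M) discharges the hypothesis of the E3′ wrapper.** Given the ONE NAMED class input (D_M)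
— every KNSS-gauge Type-I field with the Type-I decay admits the scale-invariant gauge bounds of
orders `1, 2, 3` (a published regularity statement for Type-I ancient mild solutions, NOT a
tree theorem) — the hypothesis `h` of `ExplicitThreshold.rdssClass_empty_of_explicitTimeThreshold`
(theory T31″, VERBATIM: `θ < 1`, `IsTypeIAncientMild C₀ V`, `HasTypeIDecay C₀ V`,
`√(−t)‖V(t,x)‖ ≤ θ` ⇒ `V ≡ 0`) HOLDS: swap the Type-I constant of `V` to `θ` and apply
`typeI_ancient_eq_zero_of_typeI_lt_one`. [this file; conditional on (D_M) only] -/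
theorem timeThreshold_hypothesis_of_decay
    (hD : ∀ ⦃M : ℝ⦄ ⦃V : ℝ → EuclideanSpace ℝ (Fin 3) → EuclideanSpace ℝ (Fin 3)⦄,
      IsTypeIAncientMild M V → HasTypeIDecay M V →
      ∃ C₁ C₂ C₃ : ℝ,
        (∀ t < 0, ∀ x, (‖x‖ + Real.sqrt (-t)) ^ (1 + 1) * ‖iteratedFDeriv ℝ 1 (V t) x‖ ≤ C₁) ∧
        (∀ t < 0, ∀ x, (‖x‖ + Real.sqrt (-t)) ^ (2 + 1) * ‖iteratedFDeriv ℝ 2 (V t) x‖ ≤ C₂) ∧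
        (∀ t < 0, ∀ x, (‖x‖ + Real.sqrt (-t)) ^ (3 + 1) * ‖iteratedFDeriv ℝ 3 (V t) x‖ ≤ C₃)) :
    ∀ ⦃C₀ θ : ℝ⦄ ⦃V : ℝ → EuclideanSpace ℝ (Fin 3) → EuclideanSpace ℝ (Fin 3)⦄, θ < 1 →
      IsTypeIAncientMild C₀ V → HasTypeIDecay C₀ V →
      (∀ t < 0, ∀ x, Real.sqrt (-t) * ‖V t x‖ ≤ θ) → ∀ t < 0, ∀ x, V t x = 0 := by
  intro C₀ θ V hθ hV hdec hb
  obtain ⟨C₁, C₂, C₃, hD1, hD2, hD3⟩ := hD hV hdec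
  have hVθ : IsTypeIAncientMild θ V := by
    refine ⟨hV.1, hV.2.1, hV.2.2.1, fun t ht x => ?_⟩
    have hst : 0 < Real.sqrt (-t) := Real.sqrt_pos.2 (neg_pos.2 ht)
    rw [le_div_iff₀ hst, mul_comm]
    exact hb t ht x
  exact typeI_ancient_eq_zero_of_typeI_lt_one hθ hVθ hD1 hD2 hD3

/-- **E3′ (time form) at CLASS level, GIVEN (D_M)** (theory T38-S4-BINDERS Row 2): the EXISTING
conditional wrapper `ExplicitThreshold.rdssClass_empty_of_explicitTimeThreshold` with its T31″
hypothesis discharged modulo the ONE NAMED input (D_M). Given `hD`, the hypothesis class of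
`RdssProfileTruncation` — any factor `c > 1`, ANY twist `R ∈ O(3)` — is EMPTY for every Type-I
constant `M < 1`. MECHANISM DSS-BLIND (red R-89 wording): factor, twist and `IsRotatedDSS` are
discarded; given (D_M) the statement holds for every Type-I-decay ancient mild solution with
`M < 1`. [this file; census words on ACCEPT are the lead's; conditional on (D_M); nothing numerical
is asserted and nothing here bears on NS regularity] -/
theorem rdssClass_empty_of_decay_of_typeI_lt_one
    (hD : ∀ ⦃M : ℝ⦄ ⦃V : ℝ → EuclideanSpace ℝ (Fin 3) → EuclideanSpace ℝ (Fin 3)⦄,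
      IsTypeIAncientMild M V → HasTypeIDecay M V →
      ∃ C₁ C₂ C₃ : ℝ,
        (∀ t < 0, ∀ x, (‖x‖ + Real.sqrt (-t)) ^ (1 + 1) * ‖iteratedFDeriv ℝ 1 (V t) x‖ ≤ C₁) ∧
        (∀ t < 0, ∀ x, (‖x‖ + Real.sqrt (-t)) ^ (2 + 1) * ‖iteratedFDeriv ℝ 2 (V t) x‖ ≤ C₂) ∧
        (∀ t < 0, ∀ x, (‖x‖ + Real.sqrt (-t)) ^ (3 + 1) * ‖iteratedFDeriv ℝ 3 (V t) x‖ ≤ C₃))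
    {M : ℝ} (hM : M < 1) :
    ¬ ∃ (c : ℝ) (R : (EuclideanSpace ℝ (Fin 3)) ≃ₗᵢ[ℝ] (EuclideanSpace ℝ (Fin 3)))
        (u : ℝ → (EuclideanSpace ℝ (Fin 3)) → (EuclideanSpace ℝ (Fin 3))),
      1 < c ∧ IsAncientMildSolution 1 u ∧ (∀ t < 0, AEStronglyMeasurable (u t) volume) ∧
      IsRotatedDSS c R u ∧ HasTypeIDecay M u ∧ ¬ (∀ t < 0, u t =ᵐ[volume] 0) :=
  ExplicitThreshold.rdssClass_empty_of_explicitTimeThreshold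
    (timeThreshold_hypothesis_of_decay hD) hM

end Summit.NavierStokesRegularity.NavierStokesRegularity.Theorems.SimilarityEnstrophy
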